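import Literature.MathematicalPhysics.QuantumLattice.LiebWuFillingMonotone
import HarnessLib

/-!
# Bracketing the Lieb–Wu energy at a prescribed density (`B = ∞`)

Family `hubbard`. Lieb–Wu, PRL 20 (1968) 1445, p. 1446: the cutoff `Q` is determined by the density
through (15), `∫_{-Q}^{Q} ρ = N/N_a`, the energy then being (17); Physica A 321 (2003) 1, §5, Theorem 3:
`N/N_a` is strictly increasing in `Q`. With `LiebWuFillingMonotone` (Theorem 3 at `B = ∞`: the cutoff
`liebWuCutoffAtFilling U n` at density `0 < n ≤ 1` is unique, `n ↦ e = liebWuEnergyAtFilling U n` is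
single-valued) and `LiebWuFillingContinuity` (the filling is continuous in `Q`; the energy is
Lipschitz in `Q` with constant `(2/π)(1 + 8/U)²`) this file records the elementary consequences that
turn two evaluations of the printed functions into a two-sided statement about the energy at density `n`:

* `liebWuCutoffAtFilling_mem_Icc_of_bracket`: if `0 < Q₁ ≤ Q₂ ≤ π` and
  `N/N_a(Q₁) ≤ n ≤ N/N_a(Q₂)`, then the cutoff at density `n` lies in `[Q₁, Q₂]`;
* `liebWuEnergyAtFilling_mem_of_bracket`: hence any set containing `e(Q)` for all `Q ∈ [Q₁, Q₂]`
  contains `liebWuEnergyAtFilling U n`, and (`liebWuEnergyAtFilling_mem_Icc_of_bracket`)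
  `e(Q₁) ∈ [a, b] ⇒ liebWuEnergyAtFilling U n ∈ [a - L(Q₂ - Q₁), b + L(Q₂ - Q₁)]`, `L = (2/π)(1 + 8/U)²`;
* `IsLiebWuEnergyAt.mem_Icc_of_bracket`: the same for any `e` with `IsLiebWuEnergyAt U n e`;
* `continuousOn_liebWuCutoffAtFilling`, `continuousOn_liebWuEnergyAtFilling`: the cutoff and the
  Lieb–Wu energy are continuous functions of the density on `(0, 1]`.

Nothing here is a numerical claim: the hypotheses `N/N_a(Q₁) ≤ n ≤ N/N_a(Q₂)`, `e(Q₁) ∈ [a, b]` are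
what a certified evaluation of (13)–(17) has to supply. No definition, no named fact.

## References

* E. H. Lieb, F. Y. Wu, Phys. Rev. Lett. 20 (1968) 1445, eqs. (15), (17), statement (c)
  (key `LiebWuPRL1968`); Physica A 321 (2003) 1 = arXiv:cond-mat/0207529, §5, Theorem 3
  (key `LiebWuPhysicaA2003`).
-/

noncomputable section

open Set Real

namespace Literature.MathematicalPhysics.QuantumLattice

section Bracket

variable {U Q₁ Q₂ n : ℝ}

/-- **The cutoff at density `n` is bracketed by any two cutoffs whose fillings bracket `n`:**
`0 < Q₁ ≤ Q₂ ≤ π`, `N/N_a(Q₁) ≤ n ≤ N/N_a(Q₂)` ⇒ `liebWuCutoffAtFilling U n ∈ [Q₁, Q₂]`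
(intermediate value theorem and uniqueness of the cutoff, Theorem 3). [cite: LiebWuPhysicaA2003, §5, Theorem 3] -/
theorem liebWuCutoffAtFilling_mem_Icc_of_bracket (hU : 0 < U) (hQ₁ : 0 < Q₁) (hQ₁₂ : Q₁ ≤ Q₂)
    (hQ₂ : Q₂ ≤ π) (hn₁ : liebWuFillingAtCutoff U Q₁ ≤ n) (hn₂ : n ≤ liebWuFillingAtCutoff U Q₂) :
    liebWuCutoffAtFilling U n ∈ Icc Q₁ Q₂ := by
  have hcont : ContinuousOn (liebWuFillingAtCutoff U) (Icc Q₁ Q₂) :=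
    (continuousOn_liebWuFillingAtCutoff hU).mono fun Q hQ => ⟨hQ₁.trans_le hQ.1, hQ.2.trans hQ₂⟩
  obtain ⟨Q, hQ, hQn⟩ := intermediate_value_Icc hQ₁₂ hcont ⟨hn₁, hn₂⟩
  rw [liebWuCutoffAtFilling_eq_of_filling_eq hU ⟨hQ₁.trans_le hQ.1, hQ.2.trans hQ₂⟩ hQn]
  exact hQ

/-- Under such a bracket the density is admissible: `n ∈ (0, 1]`. [cite: LiebWuPhysicaA2003, §5, Theorem 3] -/
theorem liebWuDensity_mem_Ioc_of_bracket (hU : 0 < U) (hQ₁ : 0 < Q₁) (hQ₁₂ : Q₁ ≤ Q₂) (hQ₂ : Q₂ ≤ π)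
    (hn₁ : liebWuFillingAtCutoff U Q₁ ≤ n) (hn₂ : n ≤ liebWuFillingAtCutoff U Q₂) :
    n ∈ Ioc (0 : ℝ) 1 :=
  ⟨(liebWuFillingAtCutoff_pos hU hQ₁ (hQ₁₂.trans hQ₂)).trans_le hn₁,
    hn₂.trans (liebWuFillingAtCutoff_le_one hU (hQ₁.trans_le hQ₁₂) hQ₂)⟩

/-- **Any enclosure of `e(Q)` valid on the bracket encloses the Lieb–Wu energy at density `n`.**
[cite: LiebWuPRL1968, eqs. (15), (17)] -/
theorem liebWuEnergyAtFilling_mem_of_bracket (hU : 0 < U) (hQ₁ : 0 < Q₁) (hQ₁₂ : Q₁ ≤ Q₂)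
    (hQ₂ : Q₂ ≤ π) (hn₁ : liebWuFillingAtCutoff U Q₁ ≤ n) (hn₂ : n ≤ liebWuFillingAtCutoff U Q₂)
    {S : Set ℝ} (he : ∀ Q ∈ Icc Q₁ Q₂, liebWuEnergyAtCutoff U Q ∈ S) :
    liebWuEnergyAtFilling U n ∈ S :=
  he _ (liebWuCutoffAtFilling_mem_Icc_of_bracket hU hQ₁ hQ₁₂ hQ₂ hn₁ hn₂)

/-- **Two-sided bound from one energy evaluation and the Lipschitz constant:** with
`L = (2/π)(1 + 8/U)²`, `e(Q₁) ∈ [a, b]` and the bracket `N/N_a(Q₁) ≤ n ≤ N/N_a(Q₂)` give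
`liebWuEnergyAtFilling U n ∈ [a - L(Q₂ - Q₁), b + L(Q₂ - Q₁)]`. [cite: LiebWuPRL1968, eqs. (15), (17)] -/
theorem liebWuEnergyAtFilling_mem_Icc_of_bracket (hU : 0 < U) (hQ₁ : 0 < Q₁) (hQ₁₂ : Q₁ ≤ Q₂)
    (hQ₂ : Q₂ ≤ π) (hn₁ : liebWuFillingAtCutoff U Q₁ ≤ n) (hn₂ : n ≤ liebWuFillingAtCutoff U Q₂)
    {a b : ℝ} (he₁ : liebWuEnergyAtCutoff U Q₁ ∈ Icc a b) :
    liebWuEnergyAtFilling U n ∈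
      Icc (a - 2 / π * (1 + 8 / U) ^ 2 * (Q₂ - Q₁)) (b + 2 / π * (1 + 8 / U) ^ 2 * (Q₂ - Q₁)) := by
  obtain ⟨h1, h2⟩ := liebWuCutoffAtFilling_mem_Icc_of_bracket hU hQ₁ hQ₁₂ hQ₂ hn₁ hn₂
  have hL := abs_liebWuEnergyAtCutoff_sub_le hU (hQ₁.trans_le h1) (h2.trans hQ₂) hQ₁ (hQ₁₂.trans hQ₂)
  rw [abs_of_nonneg (sub_nonneg.2 h1)] at hL
  have hLQ : 2 / π * (1 + 8 / U) ^ 2 * (liebWuCutoffAtFilling U n - Q₁) ≤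
      2 / π * (1 + 8 / U) ^ 2 * (Q₂ - Q₁) :=
    mul_le_mul_of_nonneg_left (by linarith) (by positivity)
  obtain ⟨hlo, hhi⟩ := abs_le.1 (hL.trans hLQ)
  unfold liebWuEnergyAtFilling
  exact ⟨by linarith [he₁.1], by linarith [he₁.2]⟩

/-- The same bound for every `e` with `IsLiebWuEnergyAt U n e` (there is exactly one).
[cite: LiebWuPRL1968, eqs. (15), (17), statements (a)–(c)] -/
theorem IsLiebWuEnergyAt.mem_Icc_of_bracket (hU : 0 < U) {e : ℝ} (h : IsLiebWuEnergyAt U n e)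
    (hQ₁ : 0 < Q₁) (hQ₁₂ : Q₁ ≤ Q₂) (hQ₂ : Q₂ ≤ π) (hn₁ : liebWuFillingAtCutoff U Q₁ ≤ n)
    (hn₂ : n ≤ liebWuFillingAtCutoff U Q₂) {a b : ℝ} (he₁ : liebWuEnergyAtCutoff U Q₁ ∈ Icc a b) :
    e ∈ Icc (a - 2 / π * (1 + 8 / U) ^ 2 * (Q₂ - Q₁)) (b + 2 / π * (1 + 8 / U) ^ 2 * (Q₂ - Q₁)) := by
  rw [(isLiebWuEnergyAt_iff_eq_liebWuEnergyAtFilling hU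
    (liebWuDensity_mem_Ioc_of_bracket hU hQ₁ hQ₁₂ hQ₂ hn₁ hn₂)).1 h]
  exact liebWuEnergyAtFilling_mem_Icc_of_bracket hU hQ₁ hQ₁₂ hQ₂ hn₁ hn₂ he₁

/-! ### Continuity of the cutoff and of the energy as functions of the density -/

/-- **`n ↦ Q(n)` is continuous on `(0, 1]`** (the inverse of the strictly increasing continuous
`Q ↦ N/N_a`; by bracketing). [cite: LiebWuPhysicaA2003, §5, Theorem 3] -/
theorem continuousOn_liebWuCutoffAtFilling (hU : 0 < U) :
    ContinuousOn (liebWuCutoffAtFilling U) (Ioc 0 1) := by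
  have hπ := Real.pi_pos
  have hmono := liebWuFillingAtCutoff_strictMonoOn hU
  refine Metric.continuousOn_iff.2 fun n₀ hn₀ ε hε => ?_
  obtain ⟨Q₀, hQ₀⟩ : ∃ Q₀, liebWuCutoffAtFilling U n₀ = Q₀ := ⟨_, rfl⟩
  obtain ⟨hQ₀0, hQ₀π⟩ := liebWuCutoffAtFilling_mem_Ioc hU hn₀
  have hQ₀n := (liebWuCutoffAtFilling_spec hU hn₀).2
  rw [hQ₀] at hQ₀0 hQ₀π hQ₀n
  -- a cutoff below `Q₀` within `ε/2`
  obtain ⟨Qm, hQm0, hQmQ, hQmε⟩ : ∃ Qm, 0 < Qm ∧ Qm < Q₀ ∧ Q₀ - ε / 2 ≤ Qm :=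
    ⟨max (Q₀ - ε / 2) (Q₀ / 2), lt_max_of_lt_right (by linarith), max_lt (by linarith) (by linarith),
      le_max_left _ _⟩
  have hnm : liebWuFillingAtCutoff U Qm < n₀ := by
    rw [← hQ₀n]; exact hmono ⟨hQm0, by linarith⟩ ⟨hQ₀0, hQ₀π⟩ hQmQ
  rcases lt_or_eq_of_le hQ₀π with hlt | heq
  · -- a cutoff above `Q₀` within `ε/2`
    obtain ⟨Qp, hQpQ, hQpπ, hQpε⟩ : ∃ Qp, Q₀ < Qp ∧ Qp ≤ π ∧ Qp ≤ Q₀ + ε / 2 :=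
      ⟨min (Q₀ + ε / 2) π, lt_min (by linarith) hlt, min_le_right _ _, min_le_left _ _⟩
    have hnp : n₀ < liebWuFillingAtCutoff U Qp := by
      rw [← hQ₀n]; exact hmono ⟨hQ₀0, hQ₀π⟩ ⟨by linarith, hQpπ⟩ hQpQ
    refine ⟨min (n₀ - liebWuFillingAtCutoff U Qm) (liebWuFillingAtCutoff U Qp - n₀),
      lt_min (by linarith) (by linarith), fun n _ hdist => ?_⟩
    rw [Real.dist_eq] at hdist ⊢
    obtain ⟨hd1, hd2⟩ := abs_lt.1 hdist
    have hδ1 := min_le_left (n₀ - liebWuFillingAtCutoff U Qm) (liebWuFillingAtCutoff U Qp - n₀)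
    have hδ2 := min_le_right (n₀ - liebWuFillingAtCutoff U Qm) (liebWuFillingAtCutoff U Qp - n₀)
    obtain ⟨hl, hr⟩ := liebWuCutoffAtFilling_mem_Icc_of_bracket hU hQm0 (by linarith : Qm ≤ Qp) hQpπ
      (by linarith : liebWuFillingAtCutoff U Qm ≤ n) (by linarith : n ≤ liebWuFillingAtCutoff U Qp)
    rw [hQ₀, abs_lt]
    constructor <;> linarith
  · refine ⟨n₀ - liebWuFillingAtCutoff U Qm, by linarith, fun n hn hdist => ?_⟩
    rw [Real.dist_eq] at hdist ⊢
    obtain ⟨hd1, hd2⟩ := abs_lt.1 hdist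
    have hn1 : n ≤ liebWuFillingAtCutoff U π := by rw [liebWuFillingAtCutoff_pi hU]; exact hn.2
    obtain ⟨hl, hr⟩ := liebWuCutoffAtFilling_mem_Icc_of_bracket hU hQm0 (hQmQ.le.trans hQ₀π) le_rfl
      (by linarith : liebWuFillingAtCutoff U Qm ≤ n) hn1
    rw [hQ₀, abs_lt]
    constructor <;> linarith

/-- **The Lieb–Wu energy `n ↦ liebWuEnergyAtFilling U n` is continuous on `(0, 1]`** (composition of
the continuous cutoff with the Lipschitz energy). [cite: LiebWuPRL1968, eqs. (15), (17), statement (c)] -/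
theorem continuousOn_liebWuEnergyAtFilling (hU : 0 < U) :
    ContinuousOn (liebWuEnergyAtFilling U) (Ioc 0 1) := by
  have h : liebWuEnergyAtFilling U = liebWuEnergyAtCutoff U ∘ liebWuCutoffAtFilling U := rfl
  rw [h]
  exact (continuousOn_liebWuEnergyAtCutoff hU).comp (continuousOn_liebWuCutoffAtFilling hU)
    fun n hn => liebWuCutoffAtFilling_mem_Ioc hU hn

end Bracket

end Literature.MathematicalPhysics.QuantumLattice

end
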